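import Mathlib
import Literature.NumberTheory.LFunctions.SmoothNumbersGcdFibres
import Literature.NumberTheory.Transcendental.OkadaVanishingCriterionProofs
import HarnessLib

/-!
# Okada's criterion, prime form I: unit sums on the `gcd`-fibres of `M(q)` and the masses `μ_d`

Topic `Literature/NumberTheory/Transcendental`; namespace `Literature.NumberTheory.Transcendental.OkadaCriterion`.
THEOREMS only (no definition, no named fact, no `sorry`); cell pub-zeta5, P1 g58. First of two files turning the
second condition of Okada's criterion (`Σ_{m∈M(q)} (log m/m)·Σ_{j unit} f(mj) = 0`, Chatterjee–Murty's
`Σ_{b∈M(q)} ((f_b,χ₀)/b) log b = 0`, file `OkadaVanishingCriterionProofs.lean`) into the printed `ω(q)` rational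
equations `Σ_{(r,q)>1} f(r) ε(r,p) = 0` (`p ∣ q`): T. Chatterjee, M. Ram Murty, JNT **145** (2014) [ChatterjeeMurty2014],
§5 «Equivalence of Okada's criterion», **Theorem 4** with **Lemma 1** («which appears in Okada's paper [TO] without
proof»: `Σ_{j≥1} Σ_{t: p^j t ≡ r (mod q)} p^{−j} = ε(r,p)`), READ; R. Tijdeman (2002) [Tijdeman2002], Appendix,
Theorem 8 (5.4)/(5.5), READ.

## Route (disclosed deviation of equal content)

The source counts solutions of the congruences `p^j c a ≡ r (mod q)`. The kernel instead (i) splits `M(N)` into the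
fibres of `m ↦ gcd(m,N)` (file `SmoothNumbersGcdFibres.lean`), (ii) shows that the unit sums
`S(m) = Σ_{j unit} f(mj)` are constant on each fibre (a coprime residue mod `N/d` lifts to a unit mod `N`,
Mathlib `ZMod.unitsMap_surjective`), and (iii) extracts the only counting fact needed — **`μ_d · #{j unit : dj = r}
= 1`** for `d = gcd(r,N)`, `μ_d = Σ_{gcd(m,N)=d} 1/m` — from the ANALYTIC no-pole identity
`Σ_{m∈M(N)} S_g(m)/m = 0` (display (6), file `PeriodicDirichletSeriesSmoothPartLimit.lean`) applied to
`g = δ_r − φ(N)⁻¹χ₀`. Consequently `μ_d · S(d) = Σ_{gcd(r,N)=d} f(r)`.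

## What is proved (`N ≥ 1`, `M(N)` = `Nat.factoredNumbers N.primeFactors`, `χ₀ = (1 : DirichletCharacter ℂ N)`)

* `sum_units_mul_eq_sum_units_gcd` — `S(m) = S(gcd(m,N))`;
* `tsum_mul_sum_units_eq_sum_divisors` — `Σ_{m∈M(N)} w(m)S(m) = Σ_{d∣N} S(d)·Σ_{gcd(m,N)=d} w(m)` for summable `w`;
* **`tsum_indicator_gcd_inv_mul_count_eq_one`** — `μ_{gcd(r,N)} · Σ_j χ₀(j)[gcd(r,N)·j = r] = 1`;
* **`tsum_indicator_gcd_inv_mul_sum_units_eq`** — `μ_d · Σ_{j unit} f(dj) = Σ_{r : gcd(r,N)=d} f(r)` (`d ∣ N`).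

The sequel `OkadaCriterionPrimeFormProofs.lean` assembles Theorem 4 and the criterion with the `ε(r,p)`-equations.
HONEST FRAMING: elementary bookkeeping of a printed 2014 equivalence; nothing here concerns `ζ(5)`.
-/

noncomputable section

open Complex Finset Filter Topology
open Literature.NumberTheory.LFunctions.ChatterjeeMurty2014

namespace Literature.NumberTheory.Transcendental

namespace OkadaCriterion

variable {N : ℕ} [NeZero N]

/-! ### Lifting coprime residues mod `N/d` to units mod `N` -/

/-- **Lifting**: for `d ∣ N` and `x` coprime to `N/d` there is a unit `u` of `ℤ/N` with `d·x ≡ d·u (mod N)`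
(the reduction `(ℤ/N)ˣ → (ℤ/(N/d))ˣ` is onto, Mathlib `ZMod.unitsMap_surjective`). [folklore] -/
private theorem exists_unit_mul_eq {d x : ℕ} (hd : d ∣ N) (hx : x.Coprime (N / d)) :
    ∃ u : (ZMod N)ˣ, ((d * x : ℕ) : ZMod N) = (d : ZMod N) * (u : ZMod N) := by
  have hN : N ≠ 0 := NeZero.ne N
  have hNd : N / d ∣ N := Nat.div_dvd_of_dvd hd
  have hd0 : d ≠ 0 := fun h => hN (by rw [h] at hd; exact zero_dvd_iff.mp hd)
  haveI : NeZero (N / d) := ⟨(Nat.div_pos (Nat.le_of_dvd (Nat.pos_of_ne_zero hN) hd) (Nat.pos_of_ne_zero hd0)).ne'⟩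
  obtain ⟨u, hu⟩ := ZMod.unitsMap_surjective hNd (ZMod.unitOfCoprime x hx)
  refine ⟨u, ?_⟩
  have h1 : ((ZMod.unitsMap hNd u : (ZMod (N / d))ˣ) : ZMod (N / d)) = (x : ZMod (N / d)) := by
    rw [hu, ZMod.coe_unitOfCoprime]
  rw [ZMod.unitsMap_val, ZMod.cast_eq_val] at h1
  have h2 : (u : ZMod N).val ≡ x [MOD N / d] := (ZMod.natCast_eq_natCast_iff _ _ _).mp h1
  have h3 : d * (u : ZMod N).val ≡ d * x [MOD N] := by
    have h := Nat.ModEq.mul_left' d h2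
    rwa [Nat.mul_div_cancel' hd] at h
  have h4 : ((d * (u : ZMod N).val : ℕ) : ZMod N) = ((d * x : ℕ) : ZMod N) :=
    (ZMod.natCast_eq_natCast_iff _ _ _).mpr h3
  rw [← h4]
  push_cast
  rw [ZMod.natCast_zmod_val]

/-- **The unit sums `S(m) = Σ_{j unit} f(mj)` depend only on `gcd(m, N)`**: `S(m) = S(gcd(m,N))` — write
`m = gcd·x` with `x` coprime to `N/gcd`, lift `x` to a unit and re-index the units («`(f_{cb},χ) = χ(c)(f_b,χ)`» at
`χ = χ₀`, extended to non-unit `c` by the lifting). [cite: ChatterjeeMurty2014, §4–§5 (proof of Theorems 3–4)] -/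
theorem sum_units_mul_eq_sum_units_gcd (f : ZMod N → ℂ) (m : ℕ) :
    ∑ j : ZMod N, (1 : DirichletCharacter ℂ N) j * f ((m : ℕ) * j) =
      ∑ j : ZMod N, (1 : DirichletCharacter ℂ N) j * f ((Nat.gcd m N : ℕ) * j) := by
  have hN : N ≠ 0 := NeZero.ne N
  set d := Nat.gcd m N with hd
  have hdN : d ∣ N := Nat.gcd_dvd_right m N
  have hdm : d ∣ m := Nat.gcd_dvd_left m N
  have hdpos : 0 < d := Nat.gcd_pos_of_pos_right m (Nat.pos_of_ne_zero hN)
  have hcop : Nat.Coprime (m / d) (N / d) := Nat.coprime_div_gcd_div_gcd hdpos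
  obtain ⟨u, hu⟩ := exists_unit_mul_eq hdN hcop
  rw [Nat.mul_div_cancel' hdm] at hu
  have h : ∀ j : ZMod N, f ((m : ℕ) * j) = f ((u : ZMod N) * ((d : ℕ) * j)) := fun j => by
    rw [hu]; ring_nf
  simp_rw [h]
  exact sum_units_twist f u (d : ZMod N)

/-- **Fibre decomposition of a weighted smooth sum**: for a summable weight `w` on `M(N)`,
`Σ_{m∈M(N)} w(m) S(m) = Σ_{d∣N} S(d) · Σ_{m∈M(N), gcd(m,N)=d} w(m)` («Let `d = (b,q)`, so that `b = db₁` …»).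
[cite: ChatterjeeMurty2015, §3 (proof of Proposition 3.1)] [cite: ChatterjeeMurty2014, §5] -/
theorem tsum_mul_sum_units_eq_sum_divisors (f : ZMod N → ℂ) (w : ℕ → ℂ)
    (hw : Summable fun m : Nat.factoredNumbers N.primeFactors => ‖w m‖) :
    ∑' m : Nat.factoredNumbers N.primeFactors,
        w m * ∑ j : ZMod N, (1 : DirichletCharacter ℂ N) j * f ((m : ℕ) * j) =
      ∑ d ∈ N.divisors, (∑ j : ZMod N, (1 : DirichletCharacter ℂ N) j * f ((d : ℕ) * j)) *
        ∑' m : Nat.factoredNumbers N.primeFactors, (if Nat.gcd (m : ℕ) N = d then w m else 0) := by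
  classical
  have hN : N ≠ 0 := NeZero.ne N
  set S : ℕ → ℂ := fun c => ∑ j : ZMod N, (1 : DirichletCharacter ℂ N) j * f ((c : ℕ) * j) with hS
  -- pointwise: `w(m) S(m) = Σ_{d∣N} [gcd(m,N)=d] w(m) S(d)`
  have hpt : ∀ m : Nat.factoredNumbers N.primeFactors,
      w m * S m = ∑ d ∈ N.divisors, (if Nat.gcd (m : ℕ) N = d then w m else 0) * S d := by
    intro m
    have hmem : Nat.gcd (m : ℕ) N ∈ N.divisors := Nat.mem_divisors.mpr ⟨Nat.gcd_dvd_right _ _, hN⟩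
    simp_rw [ite_mul, zero_mul]
    rw [Finset.sum_ite_eq N.divisors (Nat.gcd (m : ℕ) N) (fun d => w m * S d), if_pos hmem, hS]
    beta_reduce
    rw [sum_units_mul_eq_sum_units_gcd f m]
  have hsum : ∀ d ∈ N.divisors, Summable fun m : Nat.factoredNumbers N.primeFactors =>
      (if Nat.gcd (m : ℕ) N = d then w m else 0) * S d := by
    intro d _
    refine Summable.of_norm_bounded (hw.mul_right ‖S d‖) fun m => ?_
    rw [norm_mul]
    refine mul_le_mul_of_nonneg_right ?_ (norm_nonneg _)
    split_ifs
    · exact le_rfl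
    · rw [norm_zero]; exact norm_nonneg _
  rw [tsum_congr hpt, Summable.tsum_finsetSum hsum]
  refine Finset.sum_congr rfl fun d _ => ?_
  rw [tsum_mul_right]
  show (∑' m : Nat.factoredNumbers N.primeFactors, (if Nat.gcd (m : ℕ) N = d then w m else 0)) * S d = S d * _
  rw [mul_comm]


/-! ### Counting unit solutions of `d·j = r` against the fibre masses `μ_d` -/

/-- `χ₀(x)·χ₀(x) = χ₀(x)` for the principal character (an indicator). [folklore] -/
private theorem one_apply_mul_self' (x : ZMod N) :
    (1 : DirichletCharacter ℂ N) x * (1 : DirichletCharacter ℂ N) x = (1 : DirichletCharacter ℂ N) x := by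
  by_cases hx : IsUnit x
  · rw [MulChar.one_apply hx, mul_one]
  · rw [MulChar.map_nonunit _ hx, mul_zero]

/-- For `d' ∣ N` and a unit `j`, `gcd((d'j) mod N, N) = d'`. [folklore] -/
private theorem gcd_val_mul_unit {d' : ℕ} (hd' : d' ∣ N) (j : (ZMod N)ˣ) :
    Nat.gcd (((d' : ZMod N) * (j : ZMod N)).val) N = d' := by
  have h1 : ((((d' : ZMod N) * (j : ZMod N)).val : ℕ) : ZMod N) = ((d' * (j : ZMod N).val : ℕ) : ZMod N) := by
    rw [ZMod.natCast_zmod_val]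
    push_cast
    rw [ZMod.natCast_zmod_val]
  have h2 : ((d' : ZMod N) * j).val ≡ d' * (j : ZMod N).val [MOD N] :=
    (ZMod.natCast_eq_natCast_iff _ _ _).mp h1
  rw [Nat.ModEq.gcd_eq h2, Nat.Coprime.gcd_mul_right_cancel d' (ZMod.val_coe_unit_coprime j),
    Nat.gcd_eq_left hd']

/-- The count `Σ_j χ₀(j)[d'j = r]` of unit solutions vanishes unless `d' = gcd(r, N)`. [folklore] -/
private theorem sum_units_ite_eq_zero {d' : ℕ} (hd' : d' ∣ N) (r : ZMod N) (hr : Nat.gcd r.val N ≠ d') :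
    ∑ j : ZMod N, (1 : DirichletCharacter ℂ N) j * (if (d' : ZMod N) * j = r then (1 : ℂ) else 0) = 0 := by
  refine Finset.sum_eq_zero fun j _ => ?_
  by_cases hj : IsUnit j
  · obtain ⟨u, rfl⟩ := hj
    have hne : (d' : ZMod N) * (u : ZMod N) ≠ r := by
      intro h
      exact hr (by rw [← h]; exact gcd_val_mul_unit hd' u)
    rw [if_neg hne, mul_zero]
  · rw [MulChar.map_nonunit _ hj, zero_mul]

omit [NeZero N] in
/-- `1` is the only `M(N)`-number coprime to `N`, so `μ_1 = Σ_{m∈M(N), gcd(m,N)=1} 1/m = 1`. [folklore] -/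
private theorem tsum_indicator_gcd_one :
    ∑' m : Nat.factoredNumbers N.primeFactors,
      (if Nat.gcd (m : ℕ) N = 1 then (1 : ℂ) / ((m : ℕ) : ℂ) else 0) = 1 := by
  classical
  have h1M : (1 : ℕ) ∈ Nat.factoredNumbers N.primeFactors :=
    Nat.mem_factoredNumbers'.mpr fun p hp hp1 => (hp.ne_one (Nat.dvd_one.mp hp1)).elim
  rw [tsum_eq_single (⟨1, h1M⟩ : Nat.factoredNumbers N.primeFactors)]
  · simp
  · intro m hm
    have hm1 : (m : ℕ) ≠ 1 := fun h => hm (Subtype.ext h)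
    rw [if_neg]
    intro hg
    obtain ⟨p, hp, hpm⟩ := Nat.exists_prime_and_dvd hm1
    have hpN : p ∣ N := Nat.dvd_of_mem_primeFactors (Nat.mem_factoredNumbers'.mp m.2 p hp hpm)
    have : p ∣ Nat.gcd (m : ℕ) N := Nat.dvd_gcd hpm hpN
    rw [hg] at this
    exact hp.ne_one (Nat.dvd_one.mp this)

/-- **The fibre mass times the solution count is one**: for `r ∈ ℤ/N` with `d = gcd(r, N)`,
`μ_d · #{j unit : d·j = r} = 1`, where `μ_d = Σ_{m∈M(N), gcd(m,N)=d} 1/m`. Obtained from the no-pole identity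
`Σ_{m∈M(N)} S_g(m)/m = 0` (display (6)) for `g = δ_r − φ(N)⁻¹χ₀` and the fibre decomposition — no counting of
units is needed. [cite: ChatterjeeMurty2014, §4 (display (6)) and §5 (Lemma 1)] -/
theorem tsum_indicator_gcd_inv_mul_count_eq_one (r : ZMod N) :
    (∑' m : Nat.factoredNumbers N.primeFactors,
        (if Nat.gcd (m : ℕ) N = Nat.gcd r.val N then (1 : ℂ) / ((m : ℕ) : ℂ) else 0)) *
      ∑ j : ZMod N, (1 : DirichletCharacter ℂ N) j *
        (if ((Nat.gcd r.val N : ℕ) : ZMod N) * j = r then (1 : ℂ) else 0) = 1 := by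
  classical
  have hN : N ≠ 0 := NeZero.ne N
  set d := Nat.gcd r.val N with hd
  have hdN : d ∣ N := Nat.gcd_dvd_right _ _
  have hdmem : d ∈ N.divisors := Nat.mem_divisors.mpr ⟨hdN, hN⟩
  have h1mem : 1 ∈ N.divisors := Nat.mem_divisors.mpr ⟨one_dvd N, hN⟩
  have hφ : (N.totient : ℂ) ≠ 0 := by exact_mod_cast (Nat.totient_pos.mpr (NeZero.pos N)).ne'
  have hχsum : ∑ x : ZMod N, (1 : DirichletCharacter ℂ N) x = N.totient := by
    rw [MulChar.sum_one_eq_card_units, ZMod.card_units_eq_totient]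
  -- the test function `g = δ_r − φ(N)⁻¹ χ₀`
  set g : ZMod N → ℂ := fun x => (if x = r then (1 : ℂ) else 0) - (N.totient : ℂ)⁻¹ * (1 : DirichletCharacter ℂ N) x
    with hg
  have hgsum : ∑ x : ZMod N, g x = 0 := by
    simp only [hg, Finset.sum_sub_distrib, Finset.sum_ite_eq', Finset.mem_univ, if_true, ← Finset.mul_sum, hχsum,
      inv_mul_cancel₀ hφ, sub_self]
  have h0 := tsum_sum_units_div_eq_zero g hgsum
  -- rewrite it through the fibre decomposition with `w(m) = 1/m`
  have hw : Summable fun m : Nat.factoredNumbers N.primeFactors => ‖(fun n : ℕ => (1 : ℂ) / (n : ℂ)) m‖ := by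
    refine (summable_factoredNumbers_inv (N := N)).congr fun m => ?_
    simp
  have hdec := tsum_mul_sum_units_eq_sum_divisors g (fun n : ℕ => (1 : ℂ) / (n : ℂ)) hw
  have h0' : ∑' m : Nat.factoredNumbers N.primeFactors,
      (1 : ℂ) / ((m : ℕ) : ℂ) * ∑ j : ZMod N, (1 : DirichletCharacter ℂ N) j * g ((m : ℕ) * j) = 0 := by
    rw [← h0]
    exact tsum_congr fun m => by rw [div_mul_eq_mul_div, one_mul]
  rw [hdec] at h0'
  -- the unit sums of `g` at a divisor `d'`: `#{j : d'j = r} − χ₀(d')`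
  have hSg : ∀ d' : ℕ, ∑ j : ZMod N, (1 : DirichletCharacter ℂ N) j * g ((d' : ℕ) * j) =
      ∑ j : ZMod N, (1 : DirichletCharacter ℂ N) j * (if (d' : ZMod N) * j = r then (1 : ℂ) else 0) -
        (1 : DirichletCharacter ℂ N) (d' : ZMod N) := by
    intro d'
    have h2 : ∑ j : ZMod N, (1 : DirichletCharacter ℂ N) j * (1 : DirichletCharacter ℂ N) ((d' : ZMod N) * j) =
        (1 : DirichletCharacter ℂ N) (d' : ZMod N) * N.totient := by
      rw [← hχsum, Finset.mul_sum]
      refine Finset.sum_congr rfl fun j _ => ?_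
      rw [map_mul]
      have := one_apply_mul_self' (N := N) j
      linear_combination ((1 : DirichletCharacter ℂ N) (d' : ZMod N)) * this
    simp only [hg, mul_sub, Finset.sum_sub_distrib]
    rw [show ∑ j : ZMod N, (1 : DirichletCharacter ℂ N) j * ((N.totient : ℂ)⁻¹ * (1 : DirichletCharacter ℂ N)
        ((d' : ZMod N) * j)) = (N.totient : ℂ)⁻¹ * ∑ j : ZMod N, (1 : DirichletCharacter ℂ N) j *
        (1 : DirichletCharacter ℂ N) ((d' : ZMod N) * j) by
      rw [Finset.mul_sum]; exact Finset.sum_congr rfl fun j _ => by ring, h2]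
    field_simp
  simp_rw [hSg, sub_mul, Finset.sum_sub_distrib] at h0'
  -- the first sum is the `d`-term, the second is `μ_1 = 1`
  rw [Finset.sum_eq_single_of_mem d hdmem (fun d' hd' hne => by
      rw [sum_units_ite_eq_zero (Nat.dvd_of_mem_divisors hd') r (Ne.symm hne), zero_mul])] at h0'
  rw [Finset.sum_eq_single_of_mem 1 h1mem (fun d' hd' hne => by
      have hnu : ¬ IsUnit ((d' : ℕ) : ZMod N) := by
        rw [ZMod.isUnit_iff_coprime]
        intro hc
        have := Nat.Coprime.gcd_eq_one hc
        rw [Nat.gcd_eq_left (Nat.dvd_of_mem_divisors hd')] at this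
        exact hne this
      rw [MulChar.map_nonunit _ hnu, zero_mul])] at h0'
  rw [Nat.cast_one, MulChar.one_apply isUnit_one, one_mul, tsum_indicator_gcd_one] at h0'
  rw [mul_comm]
  linear_combination h0'

/-- **From unit sums to orbit sums**: for `d ∣ N`,
`μ_d · Σ_{j unit} f(dj) = Σ_{r : gcd(r,N) = d} f(r)` — the unit sum `S(d) = φ(q)(f_d, χ₀)` weighted by the fibre
mass `μ_d` is the plain sum of `f` over the residues of gcd `d` (each such residue is `d·j` for
`μ_d⁻¹` units `j`). [cite: ChatterjeeMurty2014, §5 (proof of Theorem 4)] [cite: Tijdeman2002, Appendix, Theorem 8] -/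
theorem tsum_indicator_gcd_inv_mul_sum_units_eq {d : ℕ} (hd : d ∣ N) (f : ZMod N → ℂ) :
    (∑' m : Nat.factoredNumbers N.primeFactors,
        (if Nat.gcd (m : ℕ) N = d then (1 : ℂ) / ((m : ℕ) : ℂ) else 0)) *
      ∑ j : ZMod N, (1 : DirichletCharacter ℂ N) j * f ((d : ℕ) * j) =
      ∑ r ∈ Finset.univ.filter (fun r : ZMod N => Nat.gcd r.val N = d), f r := by
  classical
  -- regroup the unit sum by the value `r = d·j`
  have h1 : ∑ j : ZMod N, (1 : DirichletCharacter ℂ N) j * f ((d : ℕ) * j) =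
      ∑ r : ZMod N, f r * ∑ j : ZMod N, (1 : DirichletCharacter ℂ N) j *
        (if ((d : ℕ) : ZMod N) * j = r then (1 : ℂ) else 0) := by
    have h : ∀ j : ZMod N, f ((d : ℕ) * j) = ∑ r : ZMod N, (if ((d : ℕ) : ZMod N) * j = r then f r else 0) := by
      intro j
      rw [Finset.sum_ite_eq Finset.univ (((d : ℕ) : ZMod N) * j) f, if_pos (Finset.mem_univ _)]
    simp_rw [h, Finset.mul_sum]
    rw [Finset.sum_comm]
    refine Finset.sum_congr rfl fun r _ => Finset.sum_congr rfl fun j _ => ?_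
    split_ifs <;> ring
  rw [h1, Finset.mul_sum, Finset.sum_filter]
  refine Finset.sum_congr rfl fun r _ => ?_
  by_cases hr : Nat.gcd r.val N = d
  · rw [if_pos hr, ← hr, mul_left_comm, tsum_indicator_gcd_inv_mul_count_eq_one r, mul_one]
  · rw [if_neg hr, sum_units_ite_eq_zero hd r hr, mul_zero, mul_zero]


end OkadaCriterion

end Literature.NumberTheory.Transcendental

end
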